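import Literature.AlgebraicGeometry.ShimuraVarieties.UnitaryCurveSiegelChart
import HarnessLib

/-!
# The Siegel chart of the unitary Shimura curve WITH ITS RATIONAL MOVER `q_a ∈ GSp_δ(ℚ)` per adelic representative

Topic `AlgebraicGeometry/ShimuraVarieties`; namespace `Literature.AlgebraicGeometry.ShimuraVarieties.UnitaryCurve`.
THEOREMS ONLY (no `def`, no named fact, no instance, no `sorry`).  Cell `hodgecm-mathlib`, crux HLiu418 (stmt-HodgeConjecture-24832),
sub-line P6a, E-line `F0_P6a_PELWitnessE` (GEN heir A-p18 (g31)), organ **E3 FILE D** (A-p01 (g26), 2026-09-01): ★ FILE A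
`exists_sliceChart` ∕ `exists_moduliPointMapGS` and ★ FILE C `exists_siegelChartGS` RE-RUN WITH THE MOVER KEPT.  The slice chart chooses, per adelic
representative `a`, a rational `q_a ∈ GSp_δ(ℚ)` (the element of ★ `SiegelShimuraSet.mk_eq_mk_iff` at a base point) and defines the period function by
`J(Z_a(v)) = q_a⁻¹ J(v) q_a` for ALL `v` on the negative cone, with `q_a · rep(c_a) K_δ(N) = b(a) K_δ(N)`; ★ FILES A∕C export only the resulting
Shimura-set identity `[J v, b a] = [J(Z_a v), rep c_a]`, whose per-`v` movers differ by the arithmetic group `Γ_a`.  The E-line's (M) fields need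
`q_a` itself: the `𝒪_F`-action in the marking `(Z_a v, rep c_a)` of the image point is the `q_a`-CONJUGATE `q_a⁻¹ ρ(b) q_a` of the frame reading
`ρ` of ★ E1 FILE 7b (`Mρ_kottwitz` asks `Mρ a b` to commute with `J(Z_a v)`, and `(ρ b)_ℝ` commutes with `J(v)`), integral because
`q_a · rep = b(a) · κ` and `(ρ b)_𝔸` commutes with `b(a)`.

* §1 `exists_sliceChart_mover` — ★ `exists_sliceChart` + the mover clauses (Q1) `conjJ (q_ℝ)⁻¹ (J v) = jOfSiegel δ (Z v)`,
  (Q2) `q_f • (rep c) K_δ(N) = (b a) K_δ(N)`.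
* §2 `exists_moduliPointMapGS_mover` — ★ `exists_moduliPointMapGS` + `q : U(J⋆)(𝔸_f) → GSp_δ(ℚ)` with (Q1)(Q2) at `(q a, Z a, piece a)`.
* §3 HEAD `exists_siegelChartGS_mover` — ★ `exists_siegelChartGS` (all 13 clauses verbatim) + `q` + (Q1)(Q2).

HC_CM is proved only modulo the 2 remaining named inputs (hLiu418 24832, h413 24833) until rung 0 closes; this file discharges neither
(count-neutral support of 24832).

## References
* [Milne2005ShimuraVarieties] J. S. Milne, *Introduction to Shimura varieties* (2005), Lemma 5.13 p. 57, Thm. 5.16–5.17 p. 59, §6 Thm. 6.11 p. 74 and (63) p. 116.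
* [Deligne1979ShimuraVarieties] P. Deligne, *Variétés de Shimura* (1979), Prop. 2.3.10.
* [Deligne1971TravauxShimura] P. Deligne, *Travaux de Shimura* (1971), Prop. 1.15 p. 132, 4.11–4.12 pp. 148–149, Exemple 4.16 p. 150.
* [MumfordFogartyKirwan1994] D. Mumford, J. Fogarty, F. Kirwan, *Geometric Invariant Theory* (3rd ed. 1994), Appendix to Ch. 7 §A pp. 234–235.
* [RapoportSmithlingZhang2020Diagonal] M. Rapoport, B. Smithling, W. Zhang (2020), §3.2 and Prop. 3.7 (proof) pp. 11–14, §4.1 p. 17.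
* [Kottwitz1992] R. Kottwitz, JAMS 5 (1992), §5 p. 390.
-/

set_option autoImplicit false

noncomputable section

open Function Matrix NumberField IsDedekindDomain CategoryTheory CategoryTheory.Limits AlgebraicGeometry
open scoped Matrix ComplexOrder
open Literature.AlgebraicGeometry.Motives (SchemeOver ComplexPoints AlgPoints specOver)
open Literature.AlgebraicGeometry.AbelianSchemes (PolarizedAbelianSchemeWithLevel)
open Literature.NumberTheory.Automorphic (siegelUpperHalfSpace)
open Literature.NumberTheory.Automorphic.UnitaryGroup
open Literature.AlgebraicGeometry.ModuliOfAbelianVarieties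
open Literature.AlgebraicGeometry.ModuliOfAbelianVarieties.SiegelModuli (C0 mem_C0_iff jOfSiegel jOfSiegel_mem_C0)

namespace Literature.AlgebraicGeometry.ShimuraVarieties

open UnitaryCanonicalModel

namespace UnitaryCurve

variable {L : Type} [Field L] [NumberField L] [IsCMField L] {Jstar : Matrix (Fin 2) (Fin 2) L} {τ : L →+* ℂ}
variable {g : ℕ} {δ : Fin g → ℕ} {N : ℕ}
variable (J : (Fin 2 → ℂ) → Matrix (Fin g ⊕ Fin g) (Fin g ⊕ Fin g) ℝ)
  (hJ : ∀ v : Fin 2 → ℂ, v ∈ negCone (Jstar.map τ) → J v ∈ C0pm δ)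
  (b : ↥(finAdelic (↥(maximalRealSubfield L)) L (IsCMField.complexConj L) 2 Jstar) →* ↥(gspFinAdelic δ))
  (bq : ↥(rational (↥(maximalRealSubfield L)) L (IsCMField.complexConj L) 2 Jstar) →* ↥(gspRational δ))

/-! ### §1. The slice chart with its mover -/

section Slice

/-- **THE SLICE CHART WITH ITS MOVER.**  As ★ `exists_sliceChart`, and in addition the rational `q ∈ GSp_δ(ℚ)` that DEFINES the period function:
(Q1) `conjJ (q_ℝ)⁻¹ (J v) = jOfSiegel δ (Z v)` for all `v` on the negative cone, (Q2) `q_f • (rep c) K_δ(N) = (b a) K_δ(N)` (both stated under a point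
of the cone, which is where they are used; on an empty cone the statement is vacuous).  [cite: Milne2005ShimuraVarieties, Thm. 5.16 with Def. 5.15; Lemma 5.13 p. 57]
[cite: Deligne1979ShimuraVarieties, Prop. 2.3.10] -/
theorem exists_sliceChart_mover (hg : 0 < g) (hδ : ∀ i, 0 < δ i)
    (hJneg : ∀ v : Fin 2 → ℂ, v ∈ negCone (Jstar.map τ) → -J v ∈ C0 δ)
    (hZ : ∀ γ : GL (Fin g ⊕ Fin g) ℝ, γ ∈ gspReal δ → (∀ v : Fin 2 → ℂ, v ∈ negCone (Jstar.map τ) → conjJ γ (J v) ∈ C0 δ) →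
      ∃ Z : (Fin 2 → ℂ) → Matrix (Fin g) (Fin g) ℂ,
        (∀ i j : Fin g, DifferentiableOn ℂ (fun v => Z v i j) (negCone (Jstar.map τ))) ∧
          ∀ v : Fin 2 → ℂ, v ∈ negCone (Jstar.map τ) → Z v ∈ siegelUpperHalfSpace g ∧ conjJ γ (J v) = jOfSiegel δ (Z v))
    {ι : Type*} (rep : ι → ↥(gspFinAdelic δ)) (c₀ : ι)
    (hrep : ∀ x : SiegelShimuraSet δ (principalLevelSubgroup δ N), ∃ (c : ι) (W : Matrix (Fin g) (Fin g) ℂ) (hW : W ∈ siegelUpperHalfSpace g),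
      x = SiegelShimuraSet.mk δ (principalLevelSubgroup δ N) ⟨jOfSiegel δ W, C0_subset_C0pm δ (jOfSiegel_mem_C0 hδ hW)⟩ (rep c))
    (a : ↥(finAdelic (↥(maximalRealSubfield L)) L (IsCMField.complexConj L) 2 Jstar)) :
    ∃ (c : ι) (Z : (Fin 2 → ℂ) → Matrix (Fin g) (Fin g) ℂ) (q : ↥(gspRational δ)),
      (∀ i j : Fin g, DifferentiableOn ℂ (fun v => Z v i j) (negCone (Jstar.map τ))) ∧
        ∀ (v : Fin 2 → ℂ) (hv : v ∈ negCone (Jstar.map τ)), ∃ hZv : Z v ∈ siegelUpperHalfSpace g,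
          SiegelShimuraSet.mk δ (principalLevelSubgroup δ N) ⟨J v, hJ v hv⟩ (b a) =
              SiegelShimuraSet.mk δ (principalLevelSubgroup δ N) ⟨jOfSiegel δ (Z v), C0_subset_C0pm δ (jOfSiegel_mem_C0 hδ hZv)⟩ (rep c) ∧
            conjJ (((gspRationalToReal δ q)⁻¹ : ↥(gspReal δ)) : GL (Fin g ⊕ Fin g) ℝ) (J v) = jOfSiegel δ (Z v) ∧
            gspRationalToFinAdelic δ q • ((rep c : gspFinAdelic δ) : gspFinAdelic δ ⧸ principalLevelSubgroup δ N) =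
              ((b a : gspFinAdelic δ) : gspFinAdelic δ ⧸ principalLevelSubgroup δ N) := by
  by_cases hne : (negCone (Jstar.map τ)).Nonempty
  swap
  · -- empty cone: nothing to chart
    refine ⟨c₀, fun _ => 0, 1, fun i j => ?_, fun v hv => absurd ⟨v, hv⟩ hne⟩
    exact differentiableOn_const (c := (0 : ℂ))
  obtain ⟨v₀, hv₀⟩ := hne
  -- (1) the piece and the rational translate at the base point `v₀`
  obtain ⟨c, W₀, hW₀, hq⟩ := hrep (SiegelShimuraSet.mk δ (principalLevelSubgroup δ N) ⟨J v₀, hJ v₀ hv₀⟩ (b a))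
  obtain ⟨γ, hγJ, hγb⟩ := (SiegelShimuraSet.mk_eq_mk_iff δ (principalLevelSubgroup δ N) _ _ _ _).1 hq
  -- `γ⁻¹ J(v₀) γ = J(W₀) ∈ X⁺`
  set M : ↥(gspReal δ) := (gspRationalToReal δ γ)⁻¹ with hM
  have hMJ₀ : conjJ (M : GL (Fin g ⊕ Fin g) ℝ) (J v₀) = jOfSiegel δ W₀ := by
    have h := congrArg (fun J' : C0pm δ => (J' : Matrix (Fin g ⊕ Fin g) (Fin g ⊕ Fin g) ℝ)) hγJ
    simp only [coe_conjAct] at h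
    rw [hM, Subgroup.coe_inv, ← h, ← conjJ_mul, inv_mul_cancel, conjJ_one]
  -- (2) `γ⁻¹` has negative multiplier, hence moves the whole cone family into `X⁺`
  have hMC0 : ∀ v : Fin 2 → ℂ, v ∈ negCone (Jstar.map τ) → conjJ (M : GL (Fin g ⊕ Fin g) ℝ) (J v) ∈ C0 δ := by
    obtain ⟨ν, hν⟩ := exists_isMultiplier_realTypeForm M.2
    rcases lt_or_gt_of_ne (Units.ne_zero ν) with hneg | hpos
    · intro v hv
      have h := neg_conjJ_mem_C0_of_neg hν hneg (hJneg v hv)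
      rwa [conjJ_neg, neg_neg] at h
    · exfalso
      have h := conjJ_mem_C0_of_pos hν hpos (hJneg v₀ hv₀)
      rw [conjJ_neg, hMJ₀] at h
      exact neg_not_mem_C0_of_mem_C0 hg (jOfSiegel_mem_C0 hδ hW₀) h
  -- (3) the chart for `γ⁻¹`
  obtain ⟨Z, hZd, hZv⟩ := hZ (M : GL (Fin g ⊕ Fin g) ℝ) M.2 hMC0
  refine ⟨c, Z, γ, hZd, fun v hv => ⟨(hZv v hv).1, ?_, ?_, hγb⟩⟩
  · -- (4) the point identity `[J v, b a] = [J(Z v), rep c]`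
    refine (SiegelShimuraSet.mk_eq_mk_iff δ (principalLevelSubgroup δ N) _ _ _ _).2 ⟨γ, Subtype.ext ?_, hγb⟩
    rw [coe_conjAct]
    change conjJ _ (jOfSiegel δ (Z v)) = J v
    rw [← (hZv v hv).2, hM, Subgroup.coe_inv, ← conjJ_mul, mul_inv_cancel, conjJ_one]
  · -- (Q1) the mover defines `Z`
    rw [← hM]
    exact (hZv v hv).2

end Slice

/-! ### §2. The moduli point map over abstract uniformised pieces, with its movers -/

section Moduli

/-- **THE SIEGEL MODULI POINT MAP WITH ITS MOVERS** — ★ `exists_moduliPointMapGS` re-run with the slice movers of §1 kept: the same data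
`f piece Z u rep pts` and clauses, plus `q : U(J⋆)(𝔸_f) → GSp_δ(ℚ)` with (Q1) `conjJ (q a)_ℝ⁻¹ (J v) = jOfSiegel δ (Z a v)` and (Q2)
`(q a)_f • (rep (piece a)) K_δ(N) = (b a) K_δ(N)` at every point of the cone.
[cite: Deligne1979ShimuraVarieties, Prop. 2.3.10] [cite: Milne2005ShimuraVarieties, Lemma 5.13 p. 57, Thm. 5.16, Thm. 5.17 p. 59, Thm. 6.11 p. 74]
[cite: Deligne1971TravauxShimura, Prop. 1.15 p. 132 and Exemple 4.16 p. 150] [cite: RapoportSmithlingZhang2020Diagonal, Prop. 3.7 (proof) pp. 13–14] -/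
theorem exists_moduliPointMapGS_mover (hg : 0 < g) (hδ : IsPolarizationType δ) (hN : 3 ≤ N)
    (hJneg : ∀ v : Fin 2 → ℂ, v ∈ negCone (Jstar.map τ) → -J v ∈ C0 δ)
    (hJsmul : ∀ c : ℂ, c ≠ 0 → ∀ v : Fin 2 → ℂ, v ∈ negCone (Jstar.map τ) → J (c • v) = J v)
    (hb : ∀ γ : ↥(rational (↥(maximalRealSubfield L)) L (IsCMField.complexConj L) 2 Jstar),
      b (rationalToFinAdelic (↥(maximalRealSubfield L)) L (IsCMField.complexConj L) 2 Jstar γ) = gspRationalToFinAdelic δ (bq γ))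
    (hJrat : ∀ (γ : ↥(rational (↥(maximalRealSubfield L)) L (IsCMField.complexConj L) 2 Jstar)) (v : Fin 2 → ℂ),
      v ∈ negCone (Jstar.map τ) →
        J (((ratToGLℂ L Jstar τ γ : GL (Fin 2) ℂ) : Matrix (Fin 2) (Fin 2) ℂ) *ᵥ v) =
          conjJ ((gspRationalToReal δ (bq γ) : ↥(gspReal δ)) : GL (Fin g ⊕ Fin g) ℝ) (J v))
    (K : Subgroup ↥(finAdelic (↥(maximalRealSubfield L)) L (IsCMField.complexConj L) 2 Jstar))
    (hle : K ≤ (principalLevelSubgroup δ N).comap b)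
    (hZ : ∀ γ : GL (Fin g ⊕ Fin g) ℝ, γ ∈ gspReal δ → (∀ v : Fin 2 → ℂ, v ∈ negCone (Jstar.map τ) → conjJ γ (J v) ∈ C0 δ) →
      ∃ Z : (Fin 2 → ℂ) → Matrix (Fin g) (Fin g) ℂ,
        (∀ i j : Fin g, DifferentiableOn ℂ (fun v => Z v i j) (negCone (Jstar.map τ))) ∧
          ∀ v : Fin 2 → ℂ, v ∈ negCone (Jstar.map τ) → Z v ∈ siegelUpperHalfSpace g ∧ conjJ γ (J v) = jOfSiegel δ (Z v))
    {Mc : SchemeOver ℂ} {Sc : (ZMod N)ˣ → SchemeOver ℂ} {ιc : ∀ c, Sc c ⟶ Mc} (hc : IsColimit (Cofan.mk Mc ιc))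
    (unif : ∀ c : (ZMod N)ˣ, Matrix (Fin g) (Fin g) ℂ → ComplexPoints (Sc c))
    (hsurj : ∀ c, Set.SurjOn (unif c) (siegelUpperHalfSpace g) Set.univ)
    (hiff : ∀ c, ∀ W ∈ siegelUpperHalfSpace g, ∀ W' ∈ siegelUpperHalfSpace g,
      unif c W = unif c W' ↔ ∃ M ∈ siegelLevelGroup δ N, ∃ C : (Fin g → ℂ) ≃ₗ[ℂ] (Fin g → ℂ),
        ∀ x : Fin g ⊕ Fin g → ℝ, C (siegelPeriodMap δ W x) = siegelPeriodMap δ W' (intAct M x)) :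
    ∃ (f : ShimuraSetGS L Jstar τ K → ComplexPoints Mc)
      (piece : ↥(finAdelic (↥(maximalRealSubfield L)) L (IsCMField.complexConj L) 2 Jstar) → (ZMod N)ˣ)
      (Z : ↥(finAdelic (↥(maximalRealSubfield L)) L (IsCMField.complexConj L) 2 Jstar) → (Fin 2 → ℂ) → Matrix (Fin g) (Fin g) ℂ)
      (u : (ZMod N)ˣ → finAdeleQˣ) (rep : (ZMod N)ˣ → ↥(gspFinAdelic δ))
      (pts : ComplexPoints Mc ≃ SiegelShimuraSet δ (principalLevelSubgroup δ N))
      (q : ↥(finAdelic (↥(maximalRealSubfield L)) L (IsCMField.complexConj L) 2 Jstar) → ↥(gspRational δ)),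
      (∀ c, (∀ w, Valued.v ((u c : finAdeleQ) w) = 1) ∧ (u c : finAdeleQ) - ((c : ZMod N).val : ℕ) ∈ levelIdeal N ∧
        rep c ∈ principalLevelSubgroup δ 1 ∧
          IsMultiplier (typeFormOver δ finAdeleQ) (rep c : GL (Fin g ⊕ Fin g) finAdeleQ) (u c) ∧
            ((rep c : GL (Fin g ⊕ Fin g) finAdeleQ) : Matrix (Fin g ⊕ Fin g) (Fin g ⊕ Fin g) finAdeleQ) =
              Matrix.fromBlocks 1 0 0 ((u c : finAdeleQ) • (1 : Matrix (Fin g) (Fin g) finAdeleQ))) ∧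
      (∀ a (i j : Fin g), DifferentiableOn ℂ (fun v => Z a v i j) (negCone (Jstar.map τ))) ∧
      (∀ a (v : Fin 2 → ℂ), v ∈ negCone (Jstar.map τ) → Z a v ∈ siegelUpperHalfSpace g) ∧
      (∀ (v : Fin 2 → ℂ) (hv : v ∈ negCone (Jstar.map τ)) a,
        f (ShimuraSetGS.mk L Jstar τ K v hv a) = AlgPoints.map (ιc (piece a)) (unif (piece a) (Z a v))) ∧
      (∀ (v : Fin 2 → ℂ) (hv : v ∈ negCone (Jstar.map τ)) a,
        pts (f (ShimuraSetGS.mk L Jstar τ K v hv a)) = SiegelShimuraSet.mk δ (principalLevelSubgroup δ N) ⟨J v, hJ v hv⟩ (b a)) ∧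
      (∀ (v : Fin 2 → ℂ) (hv : v ∈ negCone (Jstar.map τ)) a, ∃ hZv : Z a v ∈ siegelUpperHalfSpace g,
        SiegelShimuraSet.mk δ (principalLevelSubgroup δ N) ⟨J v, hJ v hv⟩ (b a) =
          SiegelShimuraSet.mk δ (principalLevelSubgroup δ N)
            ⟨jOfSiegel δ (Z a v), C0_subset_C0pm δ (jOfSiegel_mem_C0 hδ.1 hZv)⟩ (rep (piece a))) ∧
      (∀ (c : (ZMod N)ˣ) (W : Matrix (Fin g) (Fin g) ℂ) (hW : W ∈ siegelUpperHalfSpace g),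
        pts (AlgPoints.map (ιc c) (unif c W)) =
          SiegelShimuraSet.mk δ (principalLevelSubgroup δ N) ⟨jOfSiegel δ W, C0_subset_C0pm δ (jOfSiegel_mem_C0 hδ.1 hW)⟩ (rep c)) ∧
      (∀ (v : Fin 2 → ℂ), v ∈ negCone (Jstar.map τ) → ∀ a,
        conjJ (((gspRationalToReal δ (q a))⁻¹ : ↥(gspReal δ)) : GL (Fin g ⊕ Fin g) ℝ) (J v) = jOfSiegel δ (Z a v) ∧
          gspRationalToFinAdelic δ (q a) • ((rep (piece a) : gspFinAdelic δ) : gspFinAdelic δ ⧸ principalLevelSubgroup δ N) =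
            ((b a : gspFinAdelic δ) : gspFinAdelic δ ⧸ principalLevelSubgroup δ N)) := by
  classical
  -- the principal dissection over the abstract pieces and the complex points of the coproduct
  obtain ⟨u, rep, e, hrep, he⟩ := exists_sigma_equiv_siegelShimuraSet_of_unif hδ hg hN unif hsurj hiff
  obtain ⟨Φ, hΦ⟩ := Motives.exists_sigmaHomeomorph_of_isColimit_cofan ℂ hc
  set pts : ComplexPoints Mc ≃ SiegelShimuraSet δ (principalLevelSubgroup δ N) := Φ.toEquiv.symm.trans e with hpts
  have hval : ∀ (c : (ZMod N)ˣ) (W : Matrix (Fin g) (Fin g) ℂ) (hW : W ∈ siegelUpperHalfSpace g),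
      pts (AlgPoints.map (ιc c) (unif c W)) =
        SiegelShimuraSet.mk δ (principalLevelSubgroup δ N) ⟨jOfSiegel δ W, C0_subset_C0pm δ (jOfSiegel_mem_C0 hδ.1 hW)⟩ (rep c) := by
    intro c W hW
    rw [hpts, Equiv.trans_apply, ← hΦ c (unif c W)]
    have h1 : Φ.toEquiv.symm (Φ ⟨c, unif c W⟩) = ⟨c, unif c W⟩ := Φ.toEquiv.symm_apply_apply _
    rw [h1]
    exact he c ⟨W, hW⟩
  -- every Siegel class is a moduli class `[J(W), rep c]`
  have hrep' : ∀ x : SiegelShimuraSet δ (principalLevelSubgroup δ N), ∃ (c : (ZMod N)ˣ) (W : Matrix (Fin g) (Fin g) ℂ)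
      (hW : W ∈ siegelUpperHalfSpace g),
      x = SiegelShimuraSet.mk δ (principalLevelSubgroup δ N) ⟨jOfSiegel δ W, C0_subset_C0pm δ (jOfSiegel_mem_C0 hδ.1 hW)⟩ (rep c) := by
    intro x
    obtain ⟨⟨c, P⟩, hcP⟩ := e.surjective x
    obtain ⟨W, hW, hWP⟩ := hsurj c (Set.mem_univ P)
    refine ⟨c, W, hW, ?_⟩
    rw [← hcP, ← hWP]
    exact he c ⟨W, hW⟩
  -- one slice chart WITH MOVER per adelic representative (a choice)
  have hslice := fun a => exists_sliceChart_mover J hJ b hg hδ.1 hJneg hZ rep 1 hrep' a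
  choose piece Z q hZd hZpt using hslice
  -- the class map of ★ FILE A §1, pulled back through `pts`
  obtain ⟨φ, hφ⟩ := exists_siegelPointMapGS J hJ b bq hJsmul hb hJrat K hle
  refine ⟨fun x => pts.symm (φ x), piece, Z, u, rep, pts, q, hrep, hZd, fun a v hv => (hZpt a v hv).1, fun v hv a => ?_,
    fun v hv a => by rw [Equiv.apply_symm_apply, hφ], fun v hv a => ⟨(hZpt a v hv).1, (hZpt a v hv).2.1⟩, hval,
    fun v hv a => (hZpt a v hv).2.2⟩
  -- `f_mk`
  obtain ⟨hZv, hmk, -⟩ := hZpt a v hv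
  rw [Equiv.symm_apply_eq, hφ, hmk, hval (piece a) (Z a v) hZv]

end Moduli

/-! ### §3. The chart on Mumford's fine moduli scheme, with its movers -/

section Chart

/-- **THE SIEGEL CHART OF THE UNITARY SHIMURA CURVE ON MUMFORD'S FINE MODULI SCHEME, WITH ITS MOVERS** — ★ `exists_siegelChartGS` (all clauses
verbatim) plus the movers `q : U(J⋆)(𝔸_f) → GSp_δ(ℚ)` with (Q1) `conjJ (q a)_ℝ⁻¹ (J v) = jOfSiegel δ (Z a v)` and (Q2)
`(q a)_f • (rep (piece a)) K_δ(N) = (b a) K_δ(N)` at every point of the cone — the input of the E-line's (M) fields (`Mρ a = (q a)⁻¹ ρ (q a)`).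
[cite: MumfordFogartyKirwan1994, Appendix to Ch. 7 §A pp. 234–235] [cite: Deligne1971TravauxShimura, Prop. 1.15 p. 132, 4.11–4.12, Exemple 4.16 p. 150]
[cite: Deligne1979ShimuraVarieties, Prop. 2.3.10] [cite: Milne2005ShimuraVarieties, Lemma 5.13 p. 57, Thm. 6.11 p. 74 and (63) p. 116]
[cite: RapoportSmithlingZhang2020Diagonal, §3.2 and Prop. 3.7 (proof) pp. 11–14, §4.1 p. 17] [cite: Kottwitz1992, §5 p. 390] -/
theorem exists_siegelChartGS_mover (hU : siegelModuli_complexUniformisation) (hg : 0 < g) (hδ : IsPolarizationType δ) (hN : 3 ≤ N)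
    (𝓜 : SiegelFineModuliScheme g N δ)
    (hJneg : ∀ v : Fin 2 → ℂ, v ∈ negCone (Jstar.map τ) → -J v ∈ C0 δ)
    (hJsmul : ∀ c : ℂ, c ≠ 0 → ∀ v : Fin 2 → ℂ, v ∈ negCone (Jstar.map τ) → J (c • v) = J v)
    (hb : ∀ γ : ↥(rational (↥(maximalRealSubfield L)) L (IsCMField.complexConj L) 2 Jstar),
      b (rationalToFinAdelic (↥(maximalRealSubfield L)) L (IsCMField.complexConj L) 2 Jstar γ) = gspRationalToFinAdelic δ (bq γ))
    (hJrat : ∀ (γ : ↥(rational (↥(maximalRealSubfield L)) L (IsCMField.complexConj L) 2 Jstar)) (v : Fin 2 → ℂ),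
      v ∈ negCone (Jstar.map τ) →
        J (((ratToGLℂ L Jstar τ γ : GL (Fin 2) ℂ) : Matrix (Fin 2) (Fin 2) ℂ) *ᵥ v) =
          conjJ ((gspRationalToReal δ (bq γ) : ↥(gspReal δ)) : GL (Fin g ⊕ Fin g) ℝ) (J v))
    (K : Subgroup ↥(finAdelic (↥(maximalRealSubfield L)) L (IsCMField.complexConj L) 2 Jstar))
    (hle : K ≤ (principalLevelSubgroup δ N).comap b)
    (hZ : ∀ γ : GL (Fin g ⊕ Fin g) ℝ, γ ∈ gspReal δ → (∀ v : Fin 2 → ℂ, v ∈ negCone (Jstar.map τ) → conjJ γ (J v) ∈ C0 δ) →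
      ∃ Z : (Fin 2 → ℂ) → Matrix (Fin g) (Fin g) ℂ,
        (∀ i j : Fin g, DifferentiableOn ℂ (fun v => Z v i j) (negCone (Jstar.map τ))) ∧
          ∀ v : Fin 2 → ℂ, v ∈ negCone (Jstar.map τ) → Z v ∈ siegelUpperHalfSpace g ∧ conjJ γ (J v) = jOfSiegel δ (Z v)) :
    haveI : IsLocallyNoetherian (specOver ℚ ℂ).left := inferInstanceAs (IsLocallyNoetherian (Spec (CommRingCat.of ℂ)))
    ∃ (Sc : (ZMod N)ˣ → SchemeOver ℂ) (ιc : ∀ c, Sc c ⟶ (Motives.baseChange ℚ ℂ).obj 𝓜.M)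
      (unif : ∀ _c : (ZMod N)ˣ, Matrix (Fin g) (Fin g) ℂ → ComplexPoints (Sc _c))
      (f : ShimuraSetGS L Jstar τ K → ComplexPoints 𝓜.M)
      (piece : ↥(finAdelic (↥(maximalRealSubfield L)) L (IsCMField.complexConj L) 2 Jstar) → (ZMod N)ˣ)
      (Z : ↥(finAdelic (↥(maximalRealSubfield L)) L (IsCMField.complexConj L) 2 Jstar) → (Fin 2 → ℂ) → Matrix (Fin g) (Fin g) ℂ)
      (u : (ZMod N)ˣ → finAdeleQˣ) (rep : (ZMod N)ˣ → ↥(gspFinAdelic δ))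
      (pts : ComplexPoints ((Motives.baseChange ℚ ℂ).obj 𝓜.M) ≃ SiegelShimuraSet δ (principalLevelSubgroup δ N))
      (q : ↥(finAdelic (↥(maximalRealSubfield L)) L (IsCMField.complexConj L) 2 Jstar) → ↥(gspRational δ)),
    -- (U1) component cofan of irreducible pieces
      Nonempty (IsColimit (Cofan.mk ((Motives.baseChange ℚ ℂ).obj 𝓜.M) ιc)) ∧
      (∀ c, IrreducibleSpace (Sc c).left) ∧
    -- (U2+) analytic clauses per piece
      (∀ c, ContinuousOn (unif c) (siegelUpperHalfSpace g)) ∧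
      (∀ c, IsOpenMap ((siegelUpperHalfSpace g).restrict (unif c))) ∧
      (∀ c, Set.SurjOn (unif c) (siegelUpperHalfSpace g) Set.univ) ∧
      (∀ c, ∀ W ∈ siegelUpperHalfSpace g, ∀ W' ∈ siegelUpperHalfSpace g,
        unif c W = unif c W' ↔ ∃ M ∈ siegelLevelGroup δ N, ∃ C : (Fin g → ℂ) ≃ₗ[ℂ] (Fin g → ℂ),
          ∀ x : Fin g ⊕ Fin g → ℝ, C (siegelPeriodMap δ W x) = siegelPeriodMap δ W' (intAct M x)) ∧
      (∀ (c : (ZMod N)ˣ) (U : (Sc c).left.affineOpens) (s : (Sc c).left.presheaf.obj (Opposite.op (↑U : (Sc c).left.Opens))),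
        DifferentiableOn ℂ (fun W ↦ AlgPoints.evalOrZero (↑U : (Sc c).left.Opens) s (unif c W))
          (siegelUpperHalfSpace g ∩ unif c ⁻¹' {P | P.pt ∈ (↑U : (Sc c).left.Opens)})) ∧
    -- principal representatives (the five (U3) premisses)
      (∀ c, (∀ w, Valued.v ((u c : finAdeleQ) w) = 1) ∧ (u c : finAdeleQ) - ((c : ZMod N).val : ℕ) ∈ levelIdeal N ∧
        rep c ∈ principalLevelSubgroup δ 1 ∧
          IsMultiplier (typeFormOver δ finAdeleQ) (rep c : GL (Fin g ⊕ Fin g) finAdeleQ) (u c) ∧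
            ((rep c : GL (Fin g ⊕ Fin g) finAdeleQ) : Matrix (Fin g ⊕ Fin g) (Fin g ⊕ Fin g) finAdeleQ) =
              Matrix.fromBlocks 1 0 0 ((u c : finAdeleQ) • (1 : Matrix (Fin g) (Fin g) finAdeleQ))) ∧
    -- (P) the point map: `Z_hol`, `Z_mem`, `f_mk`, the Shimura-set shadow
      (∀ a (i j : Fin g), DifferentiableOn ℂ (fun v => Z a v i j) (negCone (Jstar.map τ))) ∧
      (∀ a (v : Fin 2 → ℂ), v ∈ negCone (Jstar.map τ) → Z a v ∈ siegelUpperHalfSpace g) ∧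
      (∀ (v : Fin 2 → ℂ) (hv : v ∈ negCone (Jstar.map τ)) a,
        f (ShimuraSetGS.mk L Jstar τ K v hv a) =
          (AlgPoints.baseChangeEquiv (algebraMap ℚ ℂ) 𝓜.M).symm (AlgPoints.map (ιc (piece a)) (unif (piece a) (Z a v)))) ∧
      (∀ (v : Fin 2 → ℂ) (hv : v ∈ negCone (Jstar.map τ)) a,
        pts (AlgPoints.baseChangeEquiv (algebraMap ℚ ℂ) 𝓜.M (f (ShimuraSetGS.mk L Jstar τ K v hv a))) =
          SiegelShimuraSet.mk δ (principalLevelSubgroup δ N) ⟨J v, hJ v hv⟩ (b a)) ∧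
      (∀ (v : Fin 2 → ℂ) (hv : v ∈ negCone (Jstar.map τ)) a, ∃ hZv : Z a v ∈ siegelUpperHalfSpace g,
        SiegelShimuraSet.mk δ (principalLevelSubgroup δ N) ⟨J v, hJ v hv⟩ (b a) =
          SiegelShimuraSet.mk δ (principalLevelSubgroup δ N)
            ⟨jOfSiegel δ (Z a v), C0_subset_C0pm δ (jOfSiegel_mem_C0 hδ.1 hZv)⟩ (rep (piece a))) ∧
      (∀ (c : (ZMod N)ˣ) (W : Matrix (Fin g) (Fin g) ℂ) (hW : W ∈ siegelUpperHalfSpace g),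
        pts (AlgPoints.map (ιc c) (unif c W)) =
          SiegelShimuraSet.mk δ (principalLevelSubgroup δ N) ⟨jOfSiegel δ W, C0_subset_C0pm δ (jOfSiegel_mem_C0 hδ.1 hW)⟩ (rep c)) ∧
    -- (A) admissibility of the universal triple at the image point ((U3∃)) and classification ((U3-D3))
      (∀ (v : Fin 2 → ℂ) (hv : v ∈ negCone (Jstar.map τ)) a, ∃ hZv : Z a v ∈ siegelUpperHalfSpace g,
        (∃ (P' : PolarizedAbelianSchemeWithLevel g N δ (specOver ℚ ℂ).left)
            (G : P'.A.X.left ⟶ 𝓜.univ.A.X.left) (Ĝ : P'.D.hat.X.left ⟶ 𝓜.univ.D.hat.X.left),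
            P'.IsBaseChangeVia 𝓜.univ (f (ShimuraSetGS.mk L Jstar τ K v hv a)).left G Ĝ ∧
              IsAdmissibleAt hδ (rep (piece a)) (Z a v) hZv P') ∧
        ∀ P' : PolarizedAbelianSchemeWithLevel g N δ (specOver ℚ ℂ).left, IsAdmissibleAt hδ (rep (piece a)) (Z a v) hZv P' →
          f (ShimuraSetGS.mk L Jstar τ K v hv a) = 𝓜.classifyingMap (specOver ℚ ℂ) P') ∧
    -- (Q) THE MOVERS
      (∀ (v : Fin 2 → ℂ), v ∈ negCone (Jstar.map τ) → ∀ a,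
        conjJ (((gspRationalToReal δ (q a))⁻¹ : ↥(gspReal δ)) : GL (Fin g ⊕ Fin g) ℝ) (J v) = jOfSiegel δ (Z a v) ∧
          gspRationalToFinAdelic δ (q a) • ((rep (piece a) : gspFinAdelic δ) : gspFinAdelic δ ⧸ principalLevelSubgroup δ N) =
            ((b a : gspFinAdelic δ) : gspFinAdelic δ ⧸ principalLevelSubgroup δ N)) := by
  classical
  -- the clauses of (U) at `𝓜`
  obtain ⟨Sc, ιc, unif, ⟨hc⟩, hirr, hU2, hU3⟩ := hU g N δ hg hδ hN 𝓜
  have hsurj : ∀ c, Set.SurjOn (unif c) (siegelUpperHalfSpace g) Set.univ := fun c => (hU2 c).2.2.1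
  have hiff : ∀ c, ∀ W ∈ siegelUpperHalfSpace g, ∀ W' ∈ siegelUpperHalfSpace g,
      unif c W = unif c W' ↔ ∃ M ∈ siegelLevelGroup δ N, ∃ C : (Fin g → ℂ) ≃ₗ[ℂ] (Fin g → ℂ),
        ∀ x : Fin g ⊕ Fin g → ℝ, C (siegelPeriodMap δ W x) = siegelPeriodMap δ W' (intAct M x) := fun c => (hU2 c).2.2.2.1
  -- §2 over these pieces
  obtain ⟨f, piece, Z, u, rep, pts, q, hrep, hZd, hZm, hfmk, hptsf, hmkrep, hval, hq⟩ :=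
    exists_moduliPointMapGS_mover J hJ b bq hg hδ hN hJneg hJsmul hb hJrat K hle hZ hc unif hsurj hiff
  refine ⟨Sc, ιc, unif, fun x => (AlgPoints.baseChangeEquiv (algebraMap ℚ ℂ) 𝓜.M).symm (f x), piece, Z, u, rep, pts, q,
    ⟨hc⟩, hirr, fun c => (hU2 c).1, fun c => (hU2 c).2.1, hsurj, hiff, fun c => (hU2 c).2.2.2.2, hrep, hZd, hZm,
    fun v hv a => congrArg (AlgPoints.baseChangeEquiv (algebraMap ℚ ℂ) 𝓜.M).symm (hfmk v hv a),
    fun v hv a => by show pts (AlgPoints.baseChangeEquiv _ 𝓜.M ((AlgPoints.baseChangeEquiv _ 𝓜.M).symm (f _))) = _;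
                     rw [Equiv.apply_symm_apply, hptsf], hmkrep, hval,
    fun v hv a => ?_, hq⟩
  -- (U3) at `(piece a, u (piece a), rep (piece a))` and `Z a v`
  obtain ⟨hu1, hu2, hr1, hr2, hr3⟩ := hrep (piece a)
  have h3 := hU3 (piece a) (u (piece a)) (rep (piece a)) hu1 hu2 hr1 hr2 hr3 (Z a v) (hZm a v hv)
  refine ⟨hZm a v hv, ?_, fun P' hP' => ?_⟩
  · obtain ⟨P', G, Ĝ, hbc, hadm⟩ := h3.1
    refine ⟨P', G, Ĝ, ?_, hadm⟩
    simp only [hfmk]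
    exact hbc
  · show (AlgPoints.baseChangeEquiv (algebraMap ℚ ℂ) 𝓜.M).symm (f _) = _
    rw [Equiv.symm_apply_eq, hfmk]
    exact h3.2 P' hP'

end Chart

end UnitaryCurve

end Literature.AlgebraicGeometry.ShimuraVarieties

end
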